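import Literature.NumberTheory.Sieve.VaughanMeanValue
import Literature.NumberTheory.Sieve.MoebiusExpSum
import Literature.NumberTheory.Sieve.FriedlanderIwaniecPrimesVaughanEngine
import HarnessLib

/-!
# Möbius sums twisted by a character and a coprimality condition: Vaughan's decomposition

Topic `Literature/NumberTheory/Sieve`; everything in this file is PROVED (theorems, plus plain
definitions with bodies).  It is the elementary half of the tree's proof of the
**Bombieri–Vinogradov theorem for the Möbius function** (file `BombieriVinogradovMoebius.lean`;
the special case `f = μ` — and, through `λ = 𝟙_□ ⋆ μ`, `f = λ` — of É. Fouvry, G. Tenenbaum,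
*Multiplicative functions in large arithmetic progressions and applications*, Trans. Amer. Math.
Soc. 375 (2022), Theorem 1.8 [FouvryTenenbaum2021]), which follows the classical route of the
tree's proof of Bombieri–Vinogradov for `Λ` (`VaughanMeanValueDecomposition.lean`,
`VaughanMeanValue.lean`, `BombieriVinogradovReduction.lean`: Vaughan, Acta Arith. 37 (1980);
Davenport, *Multiplicative Number Theory*, ch. 28) with `ψ(y, χ)` replaced by the Möbius sums

  `M_r(X, χ) = ∑_{n ≤ X, (n, r) = 1} μ(n) χ(n)`      (`moebiusCharSum r χ X`).

The coprimality condition is forced by the reduction to primitive characters: a character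
`mod qr` induced by the primitive `χ mod q` is `n ↦ χ(n) 𝟙[(n, r) = 1]` (`copChar r χ`), and for `μ`
(unlike `Λ`) the integers `n` with `(n, r) > 1` cannot be discarded trivially.

## Contents

* `copInd r`, `copCoeff r a`, `copChar r χ`: the indicator of `(n, r) = 1`, a coefficient sequence
  and a character restricted to the integers coprime to `r` (all completely multiplicative
  operations), with their trivial API.
* `copInd_eq_sum_divisors` (`𝟙[(m,r)=1] = ∑_{e ∣ (m,r)} μ(e)`), `sum_copChar_eq`
  (`∑_{m ≤ Z, (m,r)=1} χ(m) = ∑_{e ∣ r} μ(e)χ(e) ∑_{k ≤ Z/e} χ(k)`) and the **Pólya–Vinogradov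
  inequality with a coprimality condition** `norm_sum_copChar_le`:
  `|∑_{m ≤ Z, (m,r)=1} χ(m)| ≤ τ(r) √q (1 + log q)` for primitive `χ mod q ≥ 2`
  (from `Literature.NumberTheory.Sieve.LargeSieve.polyaVinogradov`).
* `mumu U = μ_{≤U} * μ_{≤U}`, `muTail U = μ − μ_{≤U}` and Vaughan's identity for `μ`,
  `μ = 2μ_{≤U} − (μ_{≤U} * μ_{≤U}) * ζ + G_U * (μ − μ_{≤U})` (`moebius_eq_four_terms`, the tree's
  `MoebiusExpSum.moebius_eq_three_terms`; Iwaniec–Kowalski (13.40)), `G_U = (μ − μ_{≤U}) * ζ` being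
  the function `Literature.NumberTheory.Sieve.Vaughan.gU` of the `Λ`-file.
* The pieces `P₀`, `T₂'`, `T₂''`, `T₃` and `moebiusCharSum_eq_decomposition`:
  `M_r(X, χ) = 2P₀ − T₂' − T₂'' + T₃` (the tree's `PrimeSumEngine.sum_mul_conv_eq` opens a
  convolution against an arbitrary weight; `ofReal_mul_sum_copChar` moves the coprimality indicator from the weight
  `χ_r(dm)` to the coefficients, so that `T₂''`, `T₃` are sums of the dyadic blocks
  `Literature.NumberTheory.Sieve.Vaughan.blockSum` of the `Λ`-file with the SAME character `χ`:
  `T₂''_eq_sum_blockSum`, `T₃_eq_sum_blockSum`), the vanishing blocks `blockSum_mumu_eq_zero`,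
  `blockSum_gU_muTail_eq_zero`, and the coefficient mean squares `sum_sq_copCoeff_mumu_le`,
  `sum_sq_copCoeff_gU_le` (`≤ 16 M ℓ³`, `ℓ = 1 + log Y₀`), `sum_sq_copCoeff_muTail_le`,
  `sum_sq_copCoeff_one_le` (`≤ N`).

The large-sieve half (bounds for `T(·)` of each piece and the mean value theorem
`Literature.NumberTheory.Sieve.moebius_character_meanValue`) is `MoebiusCharacterMeanValue.lean`.

## References

* R. C. Vaughan, *An elementary method in prime number theory*, Acta Arith. 37 (1980), 111–115
  (the method, for `ψ(y, χ)`). [Vaughan1980]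
* H. Iwaniec, E. Kowalski, *Analytic Number Theory*, AMS 2004, §13.4, (13.39)–(13.40) (Vaughan's
  identity for `μ`). [IwaniecKowalski2004]
* É. Fouvry, G. Tenenbaum, Trans. Amer. Math. Soc. 375 (2022), 245–299, Theorem 1.8 (the statement
  served, for `f = μ, λ`). [FouvryTenenbaum2021]
-/

open Finset Real Complex

namespace Literature.NumberTheory.Sieve.VaughanMoebius

open ArithmeticFunction LargeSieve Vaughan
open scoped ArithmeticFunction.Moebius ArithmeticFunction.zeta ArithmeticFunction.sigma
/-! ### Coefficients and characters restricted to integers coprime to `r` -/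

/-- The indicator of `(n, r) = 1`, as a real number. [folklore] -/
noncomputable def copInd (r n : ℕ) : ℝ := if n.Coprime r then 1 else 0

/-- A coefficient sequence restricted to the integers coprime to `r`:
`a_r(n) = a(n) · 𝟙[(n, r) = 1]`. [folklore] -/
noncomputable def copCoeff (r : ℕ) (a : ℕ → ℝ) : ℕ → ℝ := fun n => if n.Coprime r then a n else 0

/-- A Dirichlet character `χ mod q` read modulo `qr`: `χ_r(n) = χ(n) · 𝟙[(n, r) = 1]` (the character
mod `qr` induced by `χ`, evaluated on `ℕ`). [folklore] -/
noncomputable def copChar (r : ℕ) {q : ℕ} (χ : DirichletCharacter ℂ q) (n : ℕ) : ℂ :=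
  if n.Coprime r then χ n else 0

/-- `𝟙_r` is completely multiplicative: `𝟙_r(mn) = 𝟙_r(m) 𝟙_r(n)`. [folklore] -/
theorem copInd_mul (r m n : ℕ) : copInd r (m * n) = copInd r m * copInd r n := by
  unfold copInd
  by_cases hm : m.Coprime r
  · by_cases hn : n.Coprime r
    · rw [if_pos (Nat.Coprime.mul_left hm hn), if_pos hm, if_pos hn, one_mul]
    · rw [if_neg (fun h => hn (Nat.Coprime.coprime_mul_left h)), if_neg hn, mul_zero]
  · rw [if_neg (fun h => hm (Nat.Coprime.coprime_mul_right h)), if_neg hm, zero_mul]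

/-- `a_r(n) = 𝟙_r(n) a(n)`. [folklore] -/
theorem copCoeff_apply (r : ℕ) (a : ℕ → ℝ) (n : ℕ) : copCoeff r a n = copInd r n * a n := by
  unfold copCoeff copInd; split_ifs <;> simp

/-- `|a_r(n)| ≤ |a(n)|`. [folklore] -/
theorem abs_copCoeff_le (r : ℕ) (a : ℕ → ℝ) (n : ℕ) : |copCoeff r a n| ≤ |a n| := by
  unfold copCoeff; split_ifs <;> simp

/-- `a_r(n)² ≤ a(n)²`. [folklore] -/
theorem copCoeff_sq_le (r : ℕ) (a : ℕ → ℝ) (n : ℕ) : copCoeff r a n ^ 2 ≤ a n ^ 2 := by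
  unfold copCoeff; split_ifs <;> simp [sq_nonneg]

/-- `a_r(n) = 0` where `a(n) = 0`. [folklore] -/
theorem copCoeff_eq_zero_of (r : ℕ) {a : ℕ → ℝ} {n : ℕ} (h : a n = 0) : copCoeff r a n = 0 := by
  unfold copCoeff; split_ifs <;> simp [h]

/-- `χ_r(n) = 𝟙_r(n) χ(n)`. [folklore] -/
theorem copChar_eq (r : ℕ) {q : ℕ} (χ : DirichletCharacter ℂ q) (n : ℕ) :
    copChar r χ n = (copInd r n : ℂ) * χ n := by
  unfold copChar copInd; split_ifs <;> simp

/-- `χ_r` is completely multiplicative on `ℕ`. [folklore] -/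
theorem copChar_mul (r : ℕ) {q : ℕ} (χ : DirichletCharacter ℂ q) (m n : ℕ) :
    copChar r χ (m * n) = copChar r χ m * copChar r χ n := by
  rw [copChar_eq, copChar_eq, copChar_eq, copInd_mul, Nat.cast_mul, map_mul]
  push_cast; ring

/-- `|χ_r(n)| ≤ 1`. [folklore] -/
theorem norm_copChar_le (r : ℕ) {q : ℕ} (χ : DirichletCharacter ℂ q) (n : ℕ) :
    ‖copChar r χ n‖ ≤ 1 := by
  unfold copChar; split_ifs
  · exact χ.norm_le_one _
  · simp

/-! ### Möbius inversion of the coprimality condition and Pólya–Vinogradov -/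

/-- `𝟙[(m, r) = 1] = ∑_{e ∣ r, e ∣ m} μ(e)` for `r ≠ 0` (Möbius inversion over the divisors of
`gcd(m, r)`). [folklore] -/
theorem copInd_eq_sum_divisors {r : ℕ} (hr : r ≠ 0) (m : ℕ) :
    (copInd r m : ℂ) = ∑ e ∈ r.divisors, if e ∣ m then (μ e : ℂ) else 0 := by
  rw [← sum_filter]
  have hset : r.divisors.filter (fun e => e ∣ m) = (Nat.gcd m r).divisors := by
    ext e
    simp only [mem_filter, Nat.mem_divisors, Nat.dvd_gcd_iff]
    constructor
    · rintro ⟨⟨her, -⟩, hem⟩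
      exact ⟨⟨hem, her⟩, Nat.gcd_ne_zero_right hr⟩
    · rintro ⟨⟨hem, her⟩, -⟩
      exact ⟨⟨her, hr⟩, hem⟩
  rw [hset]
  have h := congrArg (fun f : ArithmeticFunction ℤ => ((f (Nat.gcd m r) : ℤ) : ℂ))
    moebius_mul_coe_zeta
  simp only [coe_mul_zeta_apply, one_apply] at h
  push_cast at h
  rw [h]
  unfold copInd
  by_cases hc : m.Coprime r
  · rw [if_pos hc, if_pos (Nat.Coprime.gcd_eq_one hc)]; simp
  · rw [if_neg hc, if_neg (fun h' => hc h')]; simp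

/-- Summing over the multiples of `e ≥ 1` in `(0, Z]`. [folklore] -/
theorem sum_Ioc_filter_dvd_eq {M : Type*} [AddCommMonoid M] (f : ℕ → M) {e : ℕ} (he : 0 < e)
    (Z : ℕ) : ∑ m ∈ (Ioc 0 Z).filter (fun m => e ∣ m), f m = ∑ k ∈ Ioc 0 (Z / e), f (e * k) := by
  have himage : (Ioc 0 Z).filter (fun m => e ∣ m) = (Ioc 0 (Z / e)).image (fun k => e * k) := by
    ext m
    simp only [mem_filter, mem_Ioc, mem_image]
    constructor
    · rintro ⟨⟨hm0, hmZ⟩, ⟨k, rfl⟩⟩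
      refine ⟨k, ⟨Nat.pos_of_mul_pos_left hm0, ?_⟩, rfl⟩
      rw [Nat.le_div_iff_mul_le he, mul_comm]; exact hmZ
    · rintro ⟨k, ⟨hk0, hkZ⟩, rfl⟩
      rw [Nat.le_div_iff_mul_le he] at hkZ
      refine ⟨⟨Nat.mul_pos he hk0, by rw [mul_comm]; exact hkZ⟩, dvd_mul_right e k⟩
  rw [himage, sum_image]
  intro a _ b _ hab
  exact Nat.eq_of_mul_eq_mul_left he hab

/-- **Character sums with a coprimality condition**: for `r ≠ 0`,
`∑_{m ≤ Z, (m,r)=1} χ(m) = ∑_{e ∣ r} μ(e) χ(e) ∑_{k ≤ Z/e} χ(k)`. [folklore] -/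
theorem sum_copChar_eq {r : ℕ} (hr : r ≠ 0) {q : ℕ} (χ : DirichletCharacter ℂ q) (Z : ℕ) :
    ∑ m ∈ Ioc 0 Z, copChar r χ m =
      ∑ e ∈ r.divisors, (μ e : ℂ) * χ e * ∑ k ∈ Ioc 0 (Z / e), χ k := by
  calc ∑ m ∈ Ioc 0 Z, copChar r χ m
      = ∑ m ∈ Ioc 0 Z, ∑ e ∈ r.divisors, (if e ∣ m then (μ e : ℂ) else 0) * χ m := by
        refine sum_congr rfl fun m _ => ?_
        rw [copChar_eq, copInd_eq_sum_divisors hr, sum_mul]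
    _ = ∑ e ∈ r.divisors, ∑ m ∈ Ioc 0 Z, (if e ∣ m then (μ e : ℂ) else 0) * χ m := sum_comm
    _ = ∑ e ∈ r.divisors, (μ e : ℂ) * χ e * ∑ k ∈ Ioc 0 (Z / e), χ k := by
        refine sum_congr rfl fun e he => ?_
        have he0 : 0 < e := Nat.pos_of_mem_divisors he
        have h1 : ∑ m ∈ Ioc 0 Z, (if e ∣ m then (μ e : ℂ) else 0) * χ m =
            ∑ m ∈ (Ioc 0 Z).filter (fun m => e ∣ m), (μ e : ℂ) * χ m := by
          rw [sum_filter]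
          refine sum_congr rfl fun m _ => ?_
          split_ifs <;> simp
        rw [h1, sum_Ioc_filter_dvd_eq _ he0, mul_sum]
        refine sum_congr rfl fun k _ => ?_
        rw [Nat.cast_mul, map_mul]; ring

/-- **Pólya–Vinogradov with a coprimality condition**: for `χ` primitive mod `q ≥ 2` and `r ≠ 0`,
`|∑_{m ≤ Z, (m,r)=1} χ(m)| ≤ τ(r) √q (1 + log q)`. [folklore] -/
theorem norm_sum_copChar_le {r : ℕ} (hr : r ≠ 0) {q : ℕ} (hq : 2 ≤ q) {χ : DirichletCharacter ℂ q}
    (hχ : χ.IsPrimitive) (Z : ℕ) :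
    ‖∑ m ∈ Ioc 0 Z, copChar r χ m‖ ≤ (σ 0 r : ℝ) * (Real.sqrt q * (1 + Real.log q)) := by
  rw [sum_copChar_eq hr, sigma_zero_apply]
  refine (norm_sum_le _ _).trans ?_
  calc ∑ e ∈ r.divisors, ‖(μ e : ℂ) * χ e * ∑ k ∈ Ioc 0 (Z / e), χ k‖
      ≤ ∑ e ∈ r.divisors, (Real.sqrt q * (1 + Real.log q)) := by
        refine sum_le_sum fun e _ => ?_
        rw [norm_mul, norm_mul]
        have h1 : ‖(μ e : ℂ)‖ ≤ 1 := by
          rw [Complex.norm_intCast, ← Int.cast_abs]; exact_mod_cast abs_moebius_le_one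
        have h2 : ‖χ e‖ ≤ 1 := χ.norm_le_one _
        have h3 := norm_sum_Ioc_char_le hq hχ 0 (Z / e)
        have h0 : 0 ≤ Real.sqrt q * (1 + Real.log q) := by
          have : 0 ≤ Real.log q := Real.log_natCast_nonneg q
          positivity
        calc ‖(μ e : ℂ)‖ * ‖χ (e : ZMod q)‖ * ‖∑ k ∈ Ioc 0 (Z / e), χ k‖
            ≤ 1 * 1 * (Real.sqrt q * (1 + Real.log q)) :=
              mul_le_mul (mul_le_mul h1 h2 (norm_nonneg _) zero_le_one) h3 (norm_nonneg _)
                (by norm_num)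
          _ = _ := by ring
    _ = (#r.divisors : ℝ) * (Real.sqrt q * (1 + Real.log q)) := by
        rw [sum_const, nsmul_eq_mul]

/-! ### The coefficient functions of Vaughan's identity for `μ` -/

/-- The type I coefficient `c_U = μ_{≤U} * μ_{≤U}` (`|c_U| ≤ τ`, `c_U(d) = 0` for `d > U²`).
[cite: IwaniecKowalski2004, (13.40)] -/
noncomputable def mumu (U : ℕ) : ArithmeticFunction ℝ :=
  (Literature.NumberTheory.Sieve.moebiusTrunc U : ArithmeticFunction ℝ) *
    (Literature.NumberTheory.Sieve.moebiusTrunc U : ArithmeticFunction ℝ)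

/-- The type II coefficient `β_U = μ − μ_{≤U}`, i.e. `μ` restricted to `n > U`.
[cite: IwaniecKowalski2004, (13.40)] -/
noncomputable def muTail (U : ℕ) : ArithmeticFunction ℝ :=
  (μ : ArithmeticFunction ℝ) - (Literature.NumberTheory.Sieve.moebiusTrunc U : ArithmeticFunction ℝ)

/-- `|c_U(d)| ≤ τ(d)`. [folklore] -/
theorem abs_mumu_le (U d : ℕ) : |mumu U d| ≤ (#d.divisors : ℝ) :=
  MoebiusExpSum.abs_trunc_mul_trunc_le U d

/-- `c_U(d) = 0` for `d > U²`. [folklore] -/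
theorem mumu_eq_zero_of_lt {U d : ℕ} (h : U * U < d) : mumu U d = 0 :=
  MoebiusExpSum.trunc_mul_trunc_eq_zero_of_lt h

/-- `β_U(m) = μ(m)` for `m > U` and `0` otherwise. [folklore] -/
theorem muTail_apply (U m : ℕ) : muTail U m = if m ≤ U then 0 else (μ m : ℝ) :=
  MoebiusExpSum.moebius_sub_trunc_apply U m

/-- `|β_U(m)| ≤ 1`. [folklore] -/
theorem abs_muTail_le (U m : ℕ) : |muTail U m| ≤ 1 := MoebiusExpSum.abs_moebius_sub_trunc_le U m

/-- **Vaughan's identity for `μ`**: `μ = μ_{≤U} + μ_{≤U} − c_U * ζ + G_U * β_U`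
(`Literature.NumberTheory.Sieve.MoebiusExpSum.moebius_eq_three_terms`). [cite: IwaniecKowalski2004, (13.40)] -/
theorem moebius_eq_four_terms (U : ℕ) :
    (μ : ArithmeticFunction ℝ) =
      (Literature.NumberTheory.Sieve.moebiusTrunc U : ArithmeticFunction ℝ) +
        (Literature.NumberTheory.Sieve.moebiusTrunc U : ArithmeticFunction ℝ) -
        mumu U * (ζ : ArithmeticFunction ℝ) + gU U * muTail U :=
  MoebiusExpSum.moebius_eq_three_terms U

/-! ### The sum `M_r(X, χ)` and its Vaughan decomposition -/

/-- `M_r(X, χ) = ∑_{n ≤ X, (n, r) = 1} μ(n) χ(n)`, the Möbius sum twisted by the character `χ mod q`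
read modulo `qr`. [folklore] -/
noncomputable def moebiusCharSum (r : ℕ) {q : ℕ} (χ : DirichletCharacter ℂ q) (X : ℕ) : ℂ :=
  ∑ n ∈ Ioc 0 X, (μ n : ℂ) * copChar r χ n

/-- The trivial piece `P₀ = ∑_{n ≤ min(U, X)} μ(n) χ_r(n)`. [folklore] -/
noncomputable def P₀ (r U X : ℕ) {q : ℕ} (χ : DirichletCharacter ℂ q) : ℂ :=
  ∑ n ∈ Ioc 0 (min U X), (μ n : ℂ) * copChar r χ n

/-- The type I piece with `d ≤ U`: `T₂' = ∑_{d ≤ min(U,X)} c_U(d) χ_r(d) ∑_{m ≤ X/d} χ_r(m)`. [folklore] -/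
noncomputable def T₂' (r U X : ℕ) {q : ℕ} (χ : DirichletCharacter ℂ q) : ℂ :=
  ∑ d ∈ Ioc 0 (min U X), (mumu U d : ℂ) * copChar r χ d * ∑ m ∈ Ioc 0 (X / d), copChar r χ m

/-- The type I piece with `d > U`: `T₂'' = ∑_{min(U,X) < d ≤ X} c_U(d) ∑_{m ≤ X/d} χ_r(dm)`, written
with the coefficients restricted to integers coprime to `r`. [folklore] -/
noncomputable def T₂'' (r U X : ℕ) {q : ℕ} (χ : DirichletCharacter ℂ q) : ℂ :=
  ∑ d ∈ Ioc (min U X) X, (copCoeff r (mumu U) d : ℂ) *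
    ∑ m ∈ Ioc 0 (X / d), (copCoeff r (fun _ => 1) m : ℂ) * χ (d * m)

/-- The type II piece `T₃ = ∑_{d ≤ X} G_U(d) ∑_{m ≤ X/d} β_U(m) χ_r(dm)`, written with the
coefficients restricted to integers coprime to `r`. [folklore] -/
noncomputable def T₃ (r U X : ℕ) {q : ℕ} (χ : DirichletCharacter ℂ q) : ℂ :=
  ∑ d ∈ Ioc 0 X, (copCoeff r (gU U) d : ℂ) *
    ∑ m ∈ Ioc 0 (X / d), (copCoeff r (muTail U) m : ℂ) * χ (d * m)

/-- Moving the coprimality indicator from the weight to the coefficients: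
`a(d) ∑_m b(m) χ_r(dm) = a_r(d) ∑_m b_r(m) χ(dm)`. [folklore] -/
theorem ofReal_mul_sum_copChar (r : ℕ) (a b : ℕ → ℝ) (d : ℕ) (s : Finset ℕ) {q : ℕ}
    (χ : DirichletCharacter ℂ q) :
    (a d : ℂ) * ∑ m ∈ s, (b m : ℂ) * copChar r χ (d * m) =
      (copCoeff r a d : ℂ) * ∑ m ∈ s, (copCoeff r b m : ℂ) * χ (d * m) := by
  simp only [mul_sum, copCoeff_apply, copChar_eq, copInd_mul]
  refine sum_congr rfl fun m _ => ?_
  push_cast; ring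

/-- **Vaughan's decomposition of `M_r(X, χ)`**:
`M_r(X, χ) = 2 P₀ − T₂' − T₂'' + T₃`. [cite: IwaniecKowalski2004, (13.40)] -/
theorem moebiusCharSum_eq_decomposition (r U X : ℕ) {q : ℕ} (χ : DirichletCharacter ℂ q) :
    moebiusCharSum r χ X = 2 * P₀ r U X χ - T₂' r U X χ - T₂'' r U X χ + T₃ r U X χ := by
  have hμ : ∀ n : ℕ, (μ n : ℂ) =
      ((Literature.NumberTheory.Sieve.moebiusTrunc U n : ℤ) : ℂ) +
        ((Literature.NumberTheory.Sieve.moebiusTrunc U n : ℤ) : ℂ) -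
        ((mumu U * (ζ : ArithmeticFunction ℝ)) n : ℂ) + ((gU U * muTail U) n : ℂ) := by
    intro n
    have h := congrArg (fun F : ArithmeticFunction ℝ => ((F n : ℝ) : ℂ)) (moebius_eq_four_terms U)
    simp only [ArithmeticFunction.add_apply, arith_sub_apply, intCoe_apply] at h
    push_cast at h
    exact h
  -- term 0
  have h0 : ∑ n ∈ Ioc 0 X, ((Literature.NumberTheory.Sieve.moebiusTrunc U n : ℤ) : ℂ) * copChar r χ n =
      P₀ r U X χ := by
    have hvan : ∀ n, min U X < n → n ≤ X →
        ((Literature.NumberTheory.Sieve.moebiusTrunc U n : ℤ) : ℂ) * copChar r χ n = 0 := by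
      intro n hn hnX
      rw [Literature.NumberTheory.Sieve.moebiusTrunc_apply, if_neg (by omega), Int.cast_zero, zero_mul]
    rw [sum_Ioc_eq_sum_Ioc_of_eq_zero (min_le_right U X) hvan, P₀]
    refine sum_congr rfl fun n hn => ?_
    rw [mem_Ioc] at hn
    rw [Literature.NumberTheory.Sieve.moebiusTrunc_apply, if_pos (by omega)]
  -- term 2
  have h2 : ∑ n ∈ Ioc 0 X, ((mumu U * (ζ : ArithmeticFunction ℝ)) n : ℂ) * copChar r χ n =
      T₂' r U X χ + T₂'' r U X χ := by
    rw [FriedlanderIwaniecPrimes.PrimeSumEngine.sum_mul_conv_eq, T₂', T₂'',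
      ← sum_Ioc_consecutive _ (Nat.zero_le _) (min_le_right U X)]
    have hz : ∀ d ∈ Ioc 0 X, ∀ m ∈ Ioc 0 (X / d),
        (((ζ : ArithmeticFunction ℝ) m : ℝ) : ℂ) * copChar r χ (d * m) =
          ((1 : ℝ) : ℂ) * copChar r χ (d * m) := by
      intro d _ m hm
      rw [mem_Ioc] at hm
      rw [natCoe_apply, zeta_apply, if_neg (by omega)]; push_cast; ring
    congr 1
    · refine sum_congr rfl fun d hd => ?_
      have hd' : d ∈ Ioc 0 X := Ioc_subset_Ioc_right (min_le_right U X) hd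
      rw [sum_congr rfl (hz d hd'), mul_assoc]
      congr 1
      rw [mul_sum]
      refine sum_congr rfl fun m _ => ?_
      rw [copChar_mul]; push_cast; ring
    · refine sum_congr rfl fun d hd => ?_
      have hd' : d ∈ Ioc 0 X := Ioc_subset_Ioc_left (Nat.zero_le _) hd
      rw [sum_congr rfl (hz d hd'), ofReal_mul_sum_copChar]
  -- term 3
  have h3 : ∑ n ∈ Ioc 0 X, ((gU U * muTail U) n : ℂ) * copChar r χ n = T₃ r U X χ := by
    rw [FriedlanderIwaniecPrimes.PrimeSumEngine.sum_mul_conv_eq, T₃]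
    exact sum_congr rfl fun d _ => ofReal_mul_sum_copChar r _ _ d _ χ
  have hsum : moebiusCharSum r χ X =
      ∑ n ∈ Ioc 0 X, (((Literature.NumberTheory.Sieve.moebiusTrunc U n : ℤ) : ℂ) * copChar r χ n +
        ((Literature.NumberTheory.Sieve.moebiusTrunc U n : ℤ) : ℂ) * copChar r χ n -
        ((mumu U * (ζ : ArithmeticFunction ℝ)) n : ℂ) * copChar r χ n +
        ((gU U * muTail U) n : ℂ) * copChar r χ n) := by
    unfold moebiusCharSum
    exact sum_congr rfl fun n _ => by rw [hμ n]; ring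
  rw [hsum, sum_add_distrib, sum_sub_distrib, sum_add_distrib, h0, h2, h3]
  ring

/-! ### Dyadic blocks for `T₂''` and `T₃` -/

/-- `T₂''` as a sum of dyadic blocks: for `X ≤ U 2^J`,
`T₂'' = ∑_{i<J} B_{U2^i}` with `a = (c_U)_r`, `b = 𝟙_r`. [folklore] -/
theorem T₂''_eq_sum_blockSum {r U X J : ℕ} (hJ : X ≤ U * 2 ^ J) {q : ℕ} (χ : DirichletCharacter ℂ q) :
    T₂'' r U X χ =
      ∑ i ∈ range J, blockSum (copCoeff r (mumu U)) (copCoeff r fun _ => 1) (U * 2 ^ i) X χ := by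
  unfold T₂'' blockSum
  rw [sum_Ioc_min_eq hJ (fun d hd => by rw [sum_Ioc_div_eq_zero_of_lt _ hd, mul_zero]),
    sum_Ioc_mul_two_pow_eq_sum]

/-- `T₃` as a sum of dyadic blocks: for `X ≤ U 2^J`, `T₃ = ∑_{i<J} B_{U2^i}` with `a = (G_U)_r`,
`b = (β_U)_r` (the terms `d ≤ U` vanish since `G_U(d) = 0` there). [folklore] -/
theorem T₃_eq_sum_blockSum {r U X J : ℕ} (hJ : X ≤ U * 2 ^ J) {q : ℕ} (χ : DirichletCharacter ℂ q) :
    T₃ r U X χ =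
      ∑ i ∈ range J, blockSum (copCoeff r (gU U)) (copCoeff r (muTail U)) (U * 2 ^ i) X χ := by
  unfold T₃ blockSum
  rw [← sum_Ioc_consecutive _ (Nat.zero_le _) (min_le_right U X)]
  have h0 : ∑ d ∈ Ioc 0 (min U X), (copCoeff r (gU U) d : ℂ) *
      ∑ m ∈ Ioc 0 (X / d), (copCoeff r (muTail U) m : ℂ) * χ (d * m) = 0 := by
    refine sum_eq_zero fun d hd => ?_
    rw [mem_Ioc] at hd
    rw [copCoeff_eq_zero_of r (gU_eq_zero_of_le (le_trans hd.2 (min_le_left U X))),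
      Complex.ofReal_zero, zero_mul]
  rw [h0, zero_add,
    sum_Ioc_min_eq hJ (fun d hd => by rw [sum_Ioc_div_eq_zero_of_lt _ hd, mul_zero]),
    sum_Ioc_mul_two_pow_eq_sum]

/-- A block of `T₂''` beyond `U²` vanishes. [folklore] -/
theorem blockSum_mumu_eq_zero {r U M X : ℕ} (hUM : U * U ≤ M) (b : ℕ → ℝ) {q : ℕ}
    (χ : DirichletCharacter ℂ q) : blockSum (copCoeff r (mumu U)) b M X χ = 0 := by
  unfold blockSum
  refine sum_eq_zero fun d hd => ?_
  rw [mem_Ioc] at hd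
  rw [copCoeff_eq_zero_of r (mumu_eq_zero_of_lt (lt_of_le_of_lt hUM hd.1)), Complex.ofReal_zero,
    zero_mul]

/-- A block of `T₃` beyond `Y₀/U` vanishes: if `X ≤ Y₀ ≤ U M` then the block is `0`
(`m ≤ X/d < Y₀/M ≤ U` forces `β_U(m) = 0`). [folklore] -/
theorem blockSum_gU_muTail_eq_zero {r U M X Y₀ : ℕ} (hX : X ≤ Y₀) (hUM : Y₀ ≤ U * M) {q : ℕ}
    (χ : DirichletCharacter ℂ q) :
    blockSum (copCoeff r (gU U)) (copCoeff r (muTail U)) M X χ = 0 := by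
  unfold blockSum
  refine sum_eq_zero fun d hd => ?_
  rw [mem_Ioc] at hd
  have hinner : ∑ m ∈ Ioc 0 (X / d), (copCoeff r (muTail U) m : ℂ) * χ (d * m) = 0 := by
    refine sum_eq_zero fun m hm => ?_
    rw [mem_Ioc] at hm
    have hmU : m ≤ U := by
      by_contra h
      replace h := not_le.1 h
      have h1 : m * d ≤ X := (Nat.le_div_iff_mul_le (by omega)).1 hm.2
      have h2 : U * M < m * d := Nat.mul_lt_mul'' h hd.1
      omega
    have : muTail U m = 0 := by rw [muTail_apply, if_pos hmU]
    rw [copCoeff_eq_zero_of r this, Complex.ofReal_zero, zero_mul]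
  rw [hinner, mul_zero]

/-! ### Mean squares of the coefficients -/

/-- `∑_{M < d ≤ 2M} τ(d)² ≤ 16 M ℓ³` for `M ≤ Y₀`. [folklore] -/
theorem sum_Ioc_sq_card_divisors_le {M Y₀ : ℕ} (hMY : M ≤ Y₀) :
    ∑ d ∈ Ioc M (M + M), ((#d.divisors : ℕ) : ℝ) ^ 2 ≤ 16 * M * ell Y₀ ^ 3 := by
  have hℓ := ell_nonneg Y₀
  have h1 : (1 : ℝ) + Real.log ((M + M : ℕ) : ℝ) ≤ 2 * ell Y₀ := by
    have := log_le_ell_of_le_two_mul (Y₀ := Y₀) (n := M + M) (by omega)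
    have h1 := one_le_ell Y₀
    linarith
  have h0 : (0 : ℝ) ≤ 1 + Real.log ((M + M : ℕ) : ℝ) := by
    have := Real.log_natCast_nonneg (M + M); linarith
  calc ∑ d ∈ Ioc M (M + M), ((#d.divisors : ℕ) : ℝ) ^ 2
      ≤ ∑ d ∈ Ioc 0 (M + M), ((#d.divisors : ℕ) : ℝ) ^ 2 :=
        sum_le_sum_of_subset_of_nonneg (Ioc_subset_Ioc_left (Nat.zero_le M))
          fun _ _ _ => by positivity
    _ ≤ ((M + M : ℕ) : ℝ) * (1 + Real.log ((M + M : ℕ) : ℝ)) ^ 3 := sum_sq_card_divisors_le (M + M)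
    _ ≤ ((M + M : ℕ) : ℝ) * (2 * ell Y₀) ^ 3 :=
        mul_le_mul_of_nonneg_left (pow_le_pow_left₀ h0 h1 3) (Nat.cast_nonneg _)
    _ = 16 * M * ell Y₀ ^ 3 := by push_cast; ring

/-- `∑_{M < d ≤ 2M} (c_U)_r(d)² ≤ 16 M ℓ³` for `M ≤ Y₀`. [folklore] -/
theorem sum_sq_copCoeff_mumu_le (r : ℕ) {U M Y₀ : ℕ} (hMY : M ≤ Y₀) :
    ∑ d ∈ Ioc M (M + M), copCoeff r (mumu U) d ^ 2 ≤ 16 * M * ell Y₀ ^ 3 := by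
  refine le_trans (sum_le_sum fun d _ => ?_) (sum_Ioc_sq_card_divisors_le hMY)
  refine (copCoeff_sq_le r _ d).trans ?_
  rw [← sq_abs (mumu U d)]
  exact pow_le_pow_left₀ (abs_nonneg _) ((abs_mumu_le U d).trans_eq (by simp)) 2

/-- `∑_{M < d ≤ 2M} (G_U)_r(d)² ≤ 16 M ℓ³` for `M ≤ Y₀`. [folklore] -/
theorem sum_sq_copCoeff_gU_le (r : ℕ) {U M Y₀ : ℕ} (hMY : M ≤ Y₀) :
    ∑ d ∈ Ioc M (M + M), copCoeff r (gU U) d ^ 2 ≤ 16 * M * ell Y₀ ^ 3 := by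
  refine le_trans (sum_le_sum fun d _ => ?_) (sum_Ioc_sq_card_divisors_le hMY)
  refine (copCoeff_sq_le r _ d).trans ?_
  rw [← sq_abs (gU U d)]
  refine pow_le_pow_left₀ (abs_nonneg _) ((abs_gU_le U d).trans_eq ?_) 2
  rw [sigma_zero_apply]

/-- `∑_{m ≤ N} (β_U)_r(m)² ≤ N`. [folklore] -/
theorem sum_sq_copCoeff_muTail_le (r U N : ℕ) :
    ∑ m ∈ Ioc 0 N, copCoeff r (muTail U) m ^ 2 ≤ N := by
  calc ∑ m ∈ Ioc 0 N, copCoeff r (muTail U) m ^ 2 ≤ ∑ m ∈ Ioc 0 N, (1 : ℝ) := by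
        refine sum_le_sum fun m _ => (copCoeff_sq_le r _ m).trans ?_
        rw [← sq_abs (muTail U m)]
        have h := abs_muTail_le U m
        nlinarith [abs_nonneg (muTail U m)]
    _ = N := by simp

/-- `∑_{m ≤ N} 𝟙_r(m)² ≤ N`. [folklore] -/
theorem sum_sq_copCoeff_one_le (r N : ℕ) :
    ∑ m ∈ Ioc 0 N, copCoeff r (fun _ => (1 : ℝ)) m ^ 2 ≤ N := by
  calc ∑ m ∈ Ioc 0 N, copCoeff r (fun _ => (1 : ℝ)) m ^ 2 ≤ ∑ m ∈ Ioc 0 N, (1 : ℝ) :=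
        sum_le_sum fun m _ => (copCoeff_sq_le r _ m).trans (by norm_num)
    _ = N := by simp

end Literature.NumberTheory.Sieve.VaughanMoebius
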